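import Summits.QuantumFields.YangMills.Theorems.FemtoTransferGapReduction
import Literature.MathematicalPhysics.QuantumFieldTheory.WilsonFlow

/-! # Slab currency for the femto transfer operator: vacuum proxies `K^m 1` and the flowed Polyakov lift (definitions)

Support DEFINITIONS (no statements of record, no route import) for crux `RunningReduction` of route `LuscherReduction`, owner input №3
(planner ym-beyond-p1 g15, 2026-08-26; memo `MEMO-RED-slab-currency.md`, evidence #16 on stmt-QuantumFields-19978).

* `transferApply β φ = ∫ K_β(·,V) φ(V) dV` — the transfer operator of the fine `(ℤ/L)³` `SU(2)` theory applied to a function (tree kernel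
  `transferKernel su2Rep`, product Haar `configMeasure`);
* `slabGround β m = K_β^m 1` — the free-boundary slab of `m` layers read as a function of its top slice (a vacuum proxy: at fixed lattice its
  Rayleigh quotient increases to `levelValue su2Rep L β 0`);
* `polyakovSite x U : GaugeConfig 3 1 G` — the three Polyakov holonomies `lineHolonomy U μ L x` based at `x`, read as a ONE-SITE configuration;
* `flowLiftAt x₀ t f` / `flowLift t f` — the flowed Polyakov lift of a one-site function: `f ∘ polyakovSite x₀` on the Wilson-flowed configuration
  `wilsonFlow t U` at one base point, resp. its site average [cite: Luscher2010, eqs. (1.3)–(1.4)];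
* `slabTrialFn β t f m a = (Σ_j a_j · flowLift t f_j) · slabGround β m` — lifted trial states;
* (the two slab STATEMENTS `SlabTrial` / `SlabNoIntruder` — sufficient conditions for the two halves of crux `RunningReduction` by the min–max
  doors of `LuscherReductionOneSiteLevelsVariational` — are NOT declared here: they live in the owner sketch `Sketch-RED-slab.lean`, evidence #15,
  and in a future `Cruxes/RunningReduction/Lines/slab.lean`; this module carries definitions only).

HONEST FRAMING: femto-universe infrastructure (rung R2b1); nothing here bears on infinite volume or the Clay gap. -/

open MeasureTheory
open Literature.MathematicalPhysics.QuantumFieldTheory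
open Literature.MathematicalPhysics.QuantumLattice

namespace Summit.QuantumFields.YangMills.Theorems.FemtoTransferGap

/-- The transfer operator `(K_β φ)(U) = ∫ K_β(U,V) φ(V) dV` of the fine `(ℤ/L)³` theory (`SU(2)`, tree kernel `transferKernel`). [folklore] -/
noncomputable def transferApply {L : ℕ} [NeZero L] (β : ℝ) (φ : GaugeConfig 3 L SU2 → ℝ) : GaugeConfig 3 L SU2 → ℝ :=
  fun U => ∫ V, transferKernel su2Rep β U V * φ V ∂(configMeasure SU2 L)

/-- `Φ_m := K_β^m 1` — the free-boundary slab of `m` layers as a function of its top slice (vacuum proxy). [folklore] -/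
noncomputable def slabGround {L : ℕ} [NeZero L] (β : ℝ) (m : ℕ) : GaugeConfig 3 L SU2 → ℝ :=
  (transferApply (L := L) β)^[m] fun _ => 1

/-- `Φ_0 = 1` (no layers). [folklore] -/
@[simp] theorem slabGround_zero {L : ℕ} [NeZero L] (β : ℝ) : slabGround (L := L) β 0 = fun _ => 1 := rfl

/-- `Φ_{m+1} = K_β Φ_m` (one more layer). [folklore] -/
theorem slabGround_succ {L : ℕ} [NeZero L] (β : ℝ) (m : ℕ) :
    slabGround (L := L) β (m + 1) = transferApply β (slabGround β m) :=
  Function.iterate_succ_apply' _ _ _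

/-- The three Polyakov holonomies `P_μ(x) = U(x,μ) U(x+e_μ,μ) ⋯ U(x+(L−1)e_μ,μ)` based at `x`, read as a ONE-SITE configuration (the bond
`(0, μ)` of the one-point torus carries `P_μ(x)`).  A fine gauge transformation acts by simultaneous conjugation by `g(x)` (= the one-site gauge
transformation); a temporal centre twist in direction `k` multiplies `P_k` by `z` (= the one-site twist). [folklore] -/
def polyakovSite {G : Type*} [Group G] {L : ℕ} (x : Site 3 L) (U : GaugeConfig 3 L G) : GaugeConfig 3 1 G :=
  fun e => lineHolonomy U e.2 L x

/-- **The flowed Polyakov lift at base point `x₀`** of a one-site function `f` at flow time `t`: `f(P_1(x₀), P_2(x₀), P_3(x₀))` on the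
Wilson-flowed configuration `wilsonFlow t U` (intended `t ≍ L²`: a UV-safe zero-mode observable defined for every `L`).  This single-base-point
variant is the one whose σ-algebra is the SLOW variable of a Feshbach–Schur / ground-state projection (owner memo §8). [cite: Luscher2010, eqs. (1.3)–(1.4)] -/
noncomputable def flowLiftAt {L : ℕ} [NeZero L] (x₀ : Site 3 L) (t : ℝ) (f : GaugeConfig 3 1 SU2 → ℝ) (U : GaugeConfig 3 L SU2) : ℝ :=
  f (polyakovSite x₀ (wilsonFlow t U))

/-- **The flowed Polyakov lift** (site-averaged): `(#sites)⁻¹ Σ_x f(P_1(x), P_2(x), P_3(x))` on `wilsonFlow t U`. [cite: Luscher2010, eqs. (1.3)–(1.4)] -/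
noncomputable def flowLift {L : ℕ} [NeZero L] (t : ℝ) (f : GaugeConfig 3 1 SU2 → ℝ) (U : GaugeConfig 3 L SU2) : ℝ :=
  (∑ x : Site 3 L, flowLiftAt x t f U) / (Fintype.card (Site 3 L) : ℝ)

/-- `flowLift` unfolded: the site average of `f ∘ polyakovSite x ∘ wilsonFlow t`. [folklore] -/
theorem flowLift_eq {L : ℕ} [NeZero L] (t : ℝ) (f : GaugeConfig 3 1 SU2 → ℝ) (U : GaugeConfig 3 L SU2) :
    flowLift t f U = (∑ x : Site 3 L, f (polyakovSite x (wilsonFlow t U))) / (Fintype.card (Site 3 L) : ℝ) := rfl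

/-- The lifted trial state with coefficients `a`: `ψ_a = (Σ_j a_j · flowLift t f_j) · Φ_m`. [folklore] -/
noncomputable def slabTrialFn {L : ℕ} [NeZero L] (β t : ℝ) {n : ℕ} (f : Fin n → (GaugeConfig 3 1 SU2 → ℝ)) (m : ℕ)
    (a : Fin n → ℝ) : GaugeConfig 3 L SU2 → ℝ :=
  fun U => (∑ j, a j * flowLift t (f j) U) * slabGround β m U

end Summit.QuantumFields.YangMills.Theorems.FemtoTransferGap
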